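import Summits.BirchSwinnertonDyer.BirchSwinnertonDyer.Theorems.EisensteinDepletionAtTwoStarPeriodHecke
import HarnessLib

/-!
# Route `EisensteinDepletionAtTwo`, crux E1M_NSF `DepletedLambdaLawAtTwoModNSF` (stmt-BirchSwinnertonDyer-27021) / GO₂-child
# `StarGO2Sigma` (stmt-BirchSwinnertonDyer-27046): the `U_ℓ`-EIGENVALUE `ℓ/β_ℓ ∈ {1, ℓ}` of the stabilised Eisenstein period
# `φ_β = stabEisensteinPeriod N β` at a SIMPLE prime `ℓ ∥ N` (sequel of `…StarPeriodHecke`, which treats `ℓ² ∥ N`)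

Cell `bsd-rank2` (HOME run/shared/lean/pub/bsd-rank2/), seat `bsd-rank2-eng-2` GEN 16. THEOREMS ONLY — no definition, no named
fact, no `sorry`. HONEST FRAMING: Dedekind-sum bookkeeping on the Eisenstein side of lines `star` / `kummer`; nothing here reads
an analytic rank; StarGO2Sigma / E1M_NSF / BSD are NOT proved by this file (PARTITION D-0054: none — r_an ≥ 2 axis S0, door T-r3₂).

At a prime `ℓ ∥ N` the local factor of the stabilised Eisenstein series `E_β` of line `star` is the PARTIAL stabilisation
`1 − β_ℓ B_ℓ` (`β_ℓ ∈ {1, ℓ}`, `localStabCoeff` at exponent `1`), whose `U_ℓ`-eigenvalue is the complementary root `ℓ/β_ℓ`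
of `X² − (1+ℓ)X + ℓ`.  For the transfer matrices `γ_j = α_j γ α_{σ_j}^{-1} = (a + jc, (b + jd − σ_j(a + jc))/ℓ; ℓc, d − σ_j c)`
of `γ = (a b; c d) ∈ Γ₀(N)` (`α_j = (1 j; 0 ℓ)`, any integers `σ_j` with `ℓ ∣ b + jd − σ_j(a + jc)`):

* **`stabEisensteinPeriod_heckeU_sum_eq_of_factorization_eq_one`** — `β_ℓ · ∑_{j<ℓ} φ_β(γ_j) = ℓ · φ_β(γ)` EXACTLY
  (eigenvalue `ℓ` for `β_ℓ = 1`, `1` for `β_ℓ = ℓ`: ODD in both cases — the parity fact used in the audit §2 of planner memo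
  SIGMA-NSF-UNTWIST, HOME/p2/g31/).

Mechanism as in the `ℓ²` file with one `ℓ`-stratum fewer (per divisor class `t = ℓ^e t₀`, `K = |c|/t₀ = ℓK₁`: Knopp's identity
`Literature.NumberTheory.ModularForms.sum_dedekindSum_add_mul_eq` at `e = 0`, periodicity at `e = 1`, weights `(1, −β_ℓ/ℓ)`,
and `β(ℓ + 1 − β) = ℓ` for `β ∈ {1, ℓ}`; rational parts ∝ `∑_t c_t t = 0`).  Exact-rational numerics (seat folder
`work/u2/u2check.py`, levels 15 and 21): confirmed.

References: M. I. Knopp, J. Number Theory 12 (1980) 2–9 [Knopp1980]; G. Stevens, *Arithmetic on Modular Curves*, Progr. Math. 20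
(1982) §2.4–2.5 [Stevens1982].
-/

set_option linter.dupNamespace false
set_option autoImplicit false

noncomputable section

open Finset Literature.NumberTheory.ModularForms

namespace Summit.BirchSwinnertonDyer.BirchSwinnertonDyer.Theorems.DepletionAtTwo

/-! ### §1 Finite-sum plumbing (private copies of the `ℓ²` file's helpers) -/

/-- Reindexing a sum over `0, …, ℓ − 1` along a map `r` that permutes the range (injective, range-valued). [folklore] -/
private theorem sum_range_reindex {ℓ : ℕ} (r : ℕ → ℕ) (hr : ∀ j ∈ range ℓ, r j ∈ range ℓ)
    (hinj : Set.InjOn r (range ℓ : Set ℕ)) (f : ℕ → ℚ) :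
    ∑ j ∈ range ℓ, f (r j) = ∑ m ∈ range ℓ, f m := by
  have himg : (range ℓ).image r = range ℓ := by
    apply eq_of_subset_of_card_le
    · intro x hx
      rw [mem_image] at hx
      obtain ⟨j, hj, rfl⟩ := hx
      exact hr j hj
    · rw [card_image_of_injOn hinj, card_range]
  rw [← sum_image hinj, himg]

/-- Divisors of `ℓ^k · N'` with `ℓ ∤ N'` (`ℓ` prime, `N' ≠ 0`): `∑_{t ∣ ℓ^k N'} F(t) = ∑_{t₀ ∣ N'} ∑_{e ≤ k} F(ℓ^e t₀)`. [folklore] -/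
private theorem sum_divisors_primePow_mul {ℓ N' : ℕ} (hℓ : ℓ.Prime) (hN' : ¬ ℓ ∣ N') (k : ℕ)
    (F : ℕ → ℚ) :
    ∑ t ∈ (ℓ ^ k * N').divisors, F t = ∑ t₀ ∈ N'.divisors, ∑ e ∈ range (k + 1), F (ℓ ^ e * t₀) := by
  have hcop : (ℓ ^ k).Coprime N' := Nat.Coprime.pow_left k ((Nat.Prime.coprime_iff_not_dvd hℓ).mpr hN')
  rw [Nat.divisors_mul, Finset.mul_def, Finset.sum_image hcop.mul_injOn_divisors, Finset.sum_product,
    Nat.divisors_prime_pow hℓ k, Finset.sum_map, Finset.sum_comm]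
  rfl

/-! ### §2 The `U_ℓ`-eigenvalue `ℓ/β_ℓ ∈ {1, ℓ}` of `φ_β` at a simple prime `ℓ ∥ N`

At a prime `ℓ ∥ N` the local factor of `E_β` is the partial stabilisation `1 − β_ℓ B_ℓ` (`β_ℓ ∈ {1, ℓ}`), whose
`U_ℓ`-eigenvalue is the complementary root `ℓ/β_ℓ` of `X² − (1+ℓ)X + ℓ`; so `β_ℓ · ∑_j φ_β(γ_j) = ℓ · φ_β(γ)` exactly
(eigenvalue `ℓ` for `β_ℓ = 1`, eigenvalue `1` for `β_ℓ = ℓ` — ODD in both cases, the fact used in the audit of planner memo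
SIGMA-NSF-UNTWIST §2).  Same mechanism as the `ℓ²` file with one `ℓ`-stratum fewer. -/

/-- **The Dedekind-sum block at `ℓ ∥ N`.** For `ℓ` prime with `N.factorization ℓ = 1`, `β_ℓ ∈ {1, ℓ}`, `N ∣ C ≠ 0`,
`d ∈ ℤ` and integers `ρ_j` (`j < ℓ`) pairwise incongruent modulo `ℓ`:
`β_ℓ · ∑_{t ∣ N} c_t · ∑_{j<ℓ} s(d + ρ_j C, ℓC/t) = ℓ · ∑_{t ∣ N} c_t · s(d, C/t)`.  (Per class `t = ℓ^e t₀`,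
`K = C/t₀ = ℓK₁`: Knopp at `e = 0` gives `(ℓ+1)s(d,K) − s(d,K₁)`, periodicity at `e = 1` gives `ℓ·s(d,K)`, weights
`(1, −β_ℓ/ℓ)`, and `β(ℓ + 1 − β) = ℓ` for `β ∈ {1, ℓ}`.) [cite: Knopp1980, Theorem (n prime)] [cite: Stevens1982, §2.4–2.5] -/
theorem sum_divisors_stabCoeff_mul_sum_dedekindSum_eq_of_factorization_eq_one {N ℓ : ℕ} (hℓ : ℓ.Prime)
    (hℓN : N.factorization ℓ = 1) (β : ℕ → ℕ) (hβ : β ℓ = 1 ∨ β ℓ = ℓ) {C : ℕ} (hC : N ∣ C) (hC0 : C ≠ 0) (d : ℤ)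
    (ρ : ℕ → ℤ) (hinj : ∀ j ∈ range ℓ, ∀ j' ∈ range ℓ, (ℓ : ℤ) ∣ ρ j - ρ j' → j = j') :
    (β ℓ : ℚ) * ∑ t ∈ N.divisors, stabCoeff N β t * ∑ j ∈ range ℓ, dedekindSum (d + ρ j * C) (ℓ * C / t) =
      (ℓ : ℚ) * ∑ t ∈ N.divisors, stabCoeff N β t * dedekindSum d (C / t) := by
  have hN0 : N ≠ 0 := by rintro rfl; simp at hℓN
  have hℓmem : ℓ ∈ N.primeFactors := by
    rw [Nat.mem_primeFactors]; exact ⟨hℓ, Nat.dvd_of_factorization_pos (by rw [hℓN]; norm_num), hN0⟩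
  -- `N = ℓ N'`, `ℓ ∤ N'`
  set N' : ℕ := N / ℓ ^ 1 with hN'
  have hNdecomp : N = ℓ ^ 1 * N' := by
    rw [hN', ← hℓN]
    exact (Nat.ordProj_mul_ordCompl_eq_self N ℓ).symm
  have hℓN' : ¬ ℓ ∣ N' := by rw [hN', ← hℓN]; exact Nat.not_dvd_ordCompl hℓ hN0
  have hN'0 : N' ≠ 0 := by rintro h; rw [h, mul_zero] at hNdecomp; exact hN0 hNdecomp
  rw [show N.divisors = (ℓ ^ 1 * N').divisors by rw [← hNdecomp], sum_divisors_primePow_mul hℓ hℓN' 1,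
    sum_divisors_primePow_mul hℓ hℓN' 1, mul_sum, mul_sum]
  refine sum_congr rfl fun t₀ ht₀ => ?_
  rw [Nat.mem_divisors] at ht₀
  obtain ⟨ht₀N', -⟩ := ht₀
  have ht₀0 : t₀ ≠ 0 := ne_zero_of_dvd_ne_zero hN'0 ht₀N'
  have ht₀pos : 0 < t₀ := Nat.pos_of_ne_zero ht₀0
  have hℓt₀ : ¬ ℓ ∣ t₀ := fun h => hℓN' (h.trans ht₀N')
  -- `C = ℓ t₀ K₁`
  obtain ⟨K₁, hK₁⟩ : ℓ ^ 1 * t₀ ∣ C := (mul_dvd_mul_left (ℓ ^ 1) ht₀N').trans (hNdecomp ▸ hC)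
  rw [pow_one] at hK₁
  have hK₁0 : K₁ ≠ 0 := by rintro rfl; rw [mul_zero] at hK₁; exact hC0 hK₁
  have hK₁pos : 0 < K₁ := Nat.pos_of_ne_zero hK₁0
  have hℓpos := hℓ.pos
  -- the moduli
  have hm0 : ℓ * C / (ℓ ^ 0 * t₀) = ℓ * (ℓ * K₁) := by
    rw [pow_zero, one_mul, hK₁, show ℓ * (ℓ * t₀ * K₁) = t₀ * (ℓ * (ℓ * K₁)) by ring,
      Nat.mul_div_cancel_left _ ht₀pos]
  have hm1 : ℓ * C / (ℓ ^ 1 * t₀) = ℓ * K₁ := by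
    rw [pow_one, hK₁, show ℓ * (ℓ * t₀ * K₁) = ℓ * t₀ * (ℓ * K₁) by ring,
      Nat.mul_div_cancel_left _ (by positivity)]
  have hn0 : C / (ℓ ^ 0 * t₀) = ℓ * K₁ := by
    rw [pow_zero, one_mul, hK₁, show ℓ * t₀ * K₁ = t₀ * (ℓ * K₁) by ring, Nat.mul_div_cancel_left _ ht₀pos]
  have hn1 : C / (ℓ ^ 1 * t₀) = K₁ := by
    rw [pow_one, hK₁, Nat.mul_div_cancel_left _ (by positivity)]
  -- the coefficients
  have hcoef : ∀ e : ℕ, stabCoeff N β (ℓ ^ e * t₀) = localStabCoeff N β ℓ e * stabCoeff N β t₀ := by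
    intro e
    rw [stabCoeff_mul N β (pow_ne_zero _ hℓ.ne_zero) ht₀0
      ((Nat.Coprime.pow_left e ((Nat.Prime.coprime_iff_not_dvd hℓ).mpr hℓt₀))),
      stabCoeff_prime_pow N β hℓmem]
  have hlam0 : localStabCoeff N β ℓ 0 = 1 := localStabCoeff_zero N β ℓ
  have hlam1 : localStabCoeff N β ℓ 1 = -(β ℓ : ℚ) / ℓ := by
    simp [localStabCoeff, hℓN]
  -- e = 1: periodicity
  have hC' : (C : ℤ) = (ℓ : ℤ) * t₀ * K₁ := by exact_mod_cast hK₁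
  set K : ℕ := ℓ * K₁ with hK
  have hKpos : 0 < K := by positivity
  have he1 : ∑ j ∈ range ℓ, dedekindSum (d + ρ j * C) K = (ℓ : ℚ) * dedekindSum d K := by
    rw [sum_congr rfl fun j _ => show dedekindSum (d + ρ j * C) K = dedekindSum d K by
      rw [hC', show d + ρ j * ((ℓ : ℤ) * t₀ * K₁) = d + (ρ j * t₀) * ((ℓ * K₁ : ℕ) : ℤ) by push_cast; ring, hK,
        dedekindSum_add_mul]]
    rw [sum_const, card_range, nsmul_eq_mul]
  -- e = 0: reindex to Knopp's sum
  set r : ℕ → ℕ := fun j => Int.toNat ((ρ j * t₀) % ℓ) with hr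
  have hℓz : (ℓ : ℤ) ≠ 0 := by exact_mod_cast hℓ.ne_zero
  have hr_nonneg : ∀ j, 0 ≤ (ρ j * t₀) % (ℓ : ℤ) := fun j => Int.emod_nonneg _ hℓz
  have hr_cast : ∀ j, ((r j : ℕ) : ℤ) = (ρ j * t₀) % ℓ := fun j => Int.toNat_of_nonneg (hr_nonneg j)
  have hr_lt : ∀ j ∈ range ℓ, r j ∈ range ℓ := by
    intro j _
    rw [mem_range]
    have h1 : (ρ j * t₀) % (ℓ : ℤ) < ℓ := Int.emod_lt_of_pos _ (by exact_mod_cast hℓpos)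
    have := hr_cast j
    omega
  have hr_inj : Set.InjOn r (range ℓ : Set ℕ) := by
    intro j hj j' hj' e
    have e' : (ρ j * t₀) % (ℓ : ℤ) = (ρ j' * t₀) % ℓ := by rw [← hr_cast, ← hr_cast]; exact_mod_cast e
    have hdvd : (ℓ : ℤ) ∣ (ρ j - ρ j') * t₀ := by
      rw [sub_mul]; exact Int.ModEq.dvd e'.symm
    have hℓprime : Prime (ℓ : ℤ) := Nat.prime_iff_prime_int.mp hℓ
    rcases hℓprime.dvd_or_dvd hdvd with h | h
    · exact hinj j (mem_coe.mp hj) j' (mem_coe.mp hj') h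
    · exact absurd (Int.natCast_dvd_natCast.mp h) hℓt₀
  have he0 : ∑ j ∈ range ℓ, dedekindSum (d + ρ j * C) (ℓ * K) =
      ∑ m ∈ range ℓ, dedekindSum (d + m * K) (ℓ * K) := by
    have step : ∀ j ∈ range ℓ, dedekindSum (d + ρ j * C) (ℓ * K) =
        (fun m : ℕ => dedekindSum (d + m * K) (ℓ * K)) (r j) := by
      intro j _
      simp only
      have hdecomp : ρ j * t₀ = (ℓ : ℤ) * (ρ j * t₀ / ℓ) + (r j : ℕ) := by
        rw [hr_cast, Int.emod_def]; ring
      have : d + ρ j * C = (d + (r j : ℕ) * K) + (ρ j * t₀ / ℓ) * ((ℓ * K : ℕ) : ℤ) := by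
        rw [hC', hK]
        push_cast
        linear_combination ((ℓ : ℤ) * K₁) * hdecomp
      rw [this, dedekindSum_add_mul]
    rw [sum_congr rfl step]
    exact sum_range_reindex r hr_lt hr_inj (fun m : ℕ => dedekindSum (d + m * K) (ℓ * K))
  have hknopp := sum_dedekindSum_add_mul_eq hℓ d hKpos
  have hscale : dedekindSum ((ℓ : ℤ) * d) K = dedekindSum d K₁ := by
    rw [hK]; exact dedekindSum_mul_left_mul_right hℓpos d K₁
  -- assemble the two strata
  rw [show (1 + 1 : ℕ) = 2 from rfl]
  simp only [sum_range_succ, sum_range_zero, zero_add, hcoef, hlam0, hlam1, hm0, hm1, hn0, hn1]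
  rw [he0, he1]
  have hℓq : (ℓ : ℚ) ≠ 0 := by exact_mod_cast hℓ.ne_zero
  have eK : ∑ m ∈ range ℓ, dedekindSum (d + m * K) (ℓ * K) =
      ((ℓ : ℚ) + 1) * dedekindSum d K - dedekindSum d K₁ := by
    rw [← hscale]; linear_combination hknopp
  rw [eK]
  -- `β(ℓ + 1 − β) = ℓ`
  have hββ : (β ℓ : ℚ) * ((ℓ : ℚ) + 1 - β ℓ) = ℓ := by
    rcases hβ with h | h
    · rw [h]; push_cast; ring
    · rw [h]; ring
  have hℓinv : (ℓ : ℚ)⁻¹ * ℓ = 1 := inv_mul_cancel₀ hℓq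
  simp only [div_eq_mul_inv]
  linear_combination (stabCoeff N β t₀ * dedekindSum d K) * hββ +
    ((β ℓ : ℚ) * stabCoeff N β t₀ * dedekindSum d K₁ - (β ℓ : ℚ) ^ 2 * stabCoeff N β t₀ * dedekindSum d K) * hℓinv

/-- **(U3-analog) The `U_ℓ`-transfer of the stabilised Eisenstein period at a simple prime `ℓ ∥ N` has eigenvalue
`ℓ/β_ℓ`.**  Let `ℓ` be a prime with `N.factorization ℓ = 1`, `β` admissible stabilisation data (so `β_ℓ ∈ {1, ℓ}`),
`γ = (a b; c d)` with `ad − bc = 1` and `N ∣ c`, and `σ : ℕ → ℤ` with `ℓ ∣ b + jd − σ_j(a + jc)` for `j < ℓ`.  Then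
`β_ℓ · ∑_{j<ℓ} φ_β(γ_j) = ℓ · φ_β(γ)` for the transfer matrices `γ_j = (a + jc, (b + jd − σ_j(a + jc))/ℓ; ℓc, d − σ_j c)`:
the period-function form of `U_ℓ E_β = (ℓ/β_ℓ) E_β`. [cite: Stevens1982, §2.4–2.5] [cite: Knopp1980, Theorem (n prime)] -/
theorem stabEisensteinPeriod_heckeU_sum_eq_of_factorization_eq_one {N ℓ : ℕ} (hℓ : ℓ.Prime)
    (hℓN : N.factorization ℓ = 1) {β : ℕ → ℕ} (hadm : IsAdmissibleStabData N β) {a b c d : ℤ}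
    (hdet : a * d - b * c = 1) (hc : (N : ℤ) ∣ c) (σ : ℕ → ℤ)
    (hσ : ∀ j < ℓ, (ℓ : ℤ) ∣ b + j * d - σ j * (a + j * c)) :
    (β ℓ : ℚ) * ∑ j ∈ range ℓ, stabEisensteinPeriod N β (a + j * c) ((b + j * d - σ j * (a + j * c)) / ℓ)
      (ℓ * c) (d - σ j * c) = ℓ * stabEisensteinPeriod N β a b c d := by
  have hN0 : N ≠ 0 := by rintro rfl; simp at hℓN
  have hℓN' : ℓ ∣ N := Nat.dvd_of_factorization_pos (by rw [hℓN]; norm_num)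
  have hℓmem : ℓ ∈ N.primeFactors := by rw [Nat.mem_primeFactors]; exact ⟨hℓ, hℓN', hN0⟩
  have hβ : β ℓ = 1 ∨ β ℓ = ℓ := hadm.2.1 ℓ hℓmem hℓN
  have hℓc : (ℓ : ℤ) ∣ c := (Int.natCast_dvd_natCast.mpr hℓN').trans hc
  have hℓq : (ℓ : ℚ) ≠ 0 := by exact_mod_cast hℓ.ne_zero
  have hsumt : ∑ t ∈ N.divisors, stabCoeff N β t * t = 0 := sum_divisors_stabCoeff_mul_self_eq_zero hN0 hadm
  simp only [stabEisensteinPeriod_eq]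
  rw [sum_comm]
  by_cases hc0 : c = 0
  · subst hc0
    have had : a * d = 1 := by linear_combination hdet
    have hd0 : (d : ℚ) ≠ 0 := by
      have : d ≠ 0 := by rintro rfl; simp at had
      exact_mod_cast this
    have e : ∀ t ∈ N.divisors, ∑ j ∈ range ℓ, stabCoeff N β t *
        rademacherPhi (a + j * 0) (t * ((b + j * d - σ j * (a + j * 0)) / ℓ)) ((ℓ : ℤ) * 0 / t) (d - σ j * 0) =
        stabCoeff N β t * t * ∑ j ∈ range ℓ, (((b + j * d - σ j * (a + j * 0)) / ℓ : ℤ) : ℚ) / d := by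
      intro t _
      rw [mul_sum]
      refine sum_congr rfl fun j _ => ?_
      simp only [mul_zero, Int.zero_ediv, rademacherPhi_of_c_eq_zero, sub_zero]
      push_cast
      ring
    have e' : ∀ t ∈ N.divisors, stabCoeff N β t * rademacherPhi a (t * b) ((0 : ℤ) / t) d =
        stabCoeff N β t * t * ((b : ℚ) / d) := by
      intro t _
      rw [Int.zero_ediv, rademacherPhi_of_c_eq_zero]
      push_cast
      ring
    rw [sum_congr rfl e, ← sum_mul, hsumt, zero_mul, mul_zero, sum_congr rfl e', ← sum_mul, hsumt,
      zero_mul, mul_zero]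
  · set C : ℕ := c.natAbs with hC
    have hcC : c = Int.sign c * C := (Int.sign_mul_natAbs c).symm
    have hC0 : C ≠ 0 := Int.natAbs_ne_zero.mpr hc0
    have hNC : N ∣ C := Int.natCast_dvd.mp hc
    have hsgn : Int.sign c = 1 ∨ Int.sign c = -1 := by
      rcases lt_or_gt_of_ne hc0 with h | h
      · exact Or.inr (Int.sign_eq_neg_one_of_neg h)
      · exact Or.inl (Int.sign_eq_one_of_pos h)
    have hcq : (c : ℚ) ≠ 0 := by exact_mod_cast hc0
    have htC : ∀ t ∈ N.divisors, t ∣ ℓ * C := fun t ht =>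
      ((Nat.dvd_of_mem_divisors ht).trans hNC).mul_left ℓ
    have htC' : ∀ t ∈ N.divisors, t ∣ C := fun t ht => (Nat.dvd_of_mem_divisors ht).trans hNC
    have hmod_pos : ∀ t ∈ N.divisors, 0 < ℓ * C / t := fun t ht =>
      Nat.div_pos (Nat.le_of_dvd (Nat.pos_of_ne_zero (mul_ne_zero hℓ.ne_zero hC0)) (htC t ht))
        (Nat.pos_of_mem_divisors ht)
    have hmod_pos' : ∀ t ∈ N.divisors, 0 < C / t := fun t ht =>
      Nat.div_pos (Nat.le_of_dvd (Nat.pos_of_ne_zero hC0) (htC' t ht)) (Nat.pos_of_mem_divisors ht)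
    -- `(ℓc)/t = sign(c)·(ℓC/t)` and `c/t = sign(c)·(C/t)`
    have hdivt : ∀ t ∈ N.divisors, ((ℓ : ℤ) * c) / (t : ℤ) = Int.sign c * ((ℓ * C / t : ℕ) : ℤ) := by
      intro t ht
      have ht0 : (t : ℤ) ≠ 0 := by exact_mod_cast (Nat.pos_of_mem_divisors ht).ne'
      obtain ⟨u, hu⟩ := htC t ht
      have hu' : ℓ * C / t = u := by rw [hu, Nat.mul_div_cancel_left _ (Nat.pos_of_mem_divisors ht)]
      rw [hu']
      have e1 : ((ℓ * C : ℕ) : ℤ) = ((t * u : ℕ) : ℤ) := by rw [hu]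
      push_cast at e1
      have e2 : (ℓ : ℤ) * c = (t : ℤ) * (Int.sign c * u) := by
        conv_lhs => rw [hcC]
        linear_combination (Int.sign c) * e1
      rw [e2, Int.mul_ediv_cancel_left _ ht0]
    have hdivt' : ∀ t ∈ N.divisors, c / (t : ℤ) = Int.sign c * ((C / t : ℕ) : ℤ) := by
      intro t ht
      have ht0 : (t : ℤ) ≠ 0 := by exact_mod_cast (Nat.pos_of_mem_divisors ht).ne'
      obtain ⟨u, hu⟩ := htC' t ht
      have hu' : C / t = u := by rw [hu, Nat.mul_div_cancel_left _ (Nat.pos_of_mem_divisors ht)]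
      rw [hu']
      have e1 : ((C : ℕ) : ℤ) = ((t * u : ℕ) : ℤ) := by rw [hu]
      push_cast at e1
      have e2 : c = (t : ℤ) * (Int.sign c * u) := by
        conv_lhs => rw [hcC]
        linear_combination (Int.sign c) * e1
      conv_lhs => rw [e2]
      rw [Int.mul_ediv_cancel_left _ ht0]
    have hPhi : ∀ t ∈ N.divisors, ∀ j : ℕ,
        rademacherPhi (a + j * c) (t * ((b + j * d - σ j * (a + j * c)) / ℓ)) ((ℓ : ℤ) * c / t) (d - σ j * c) =
        ((a + j * c + (d - σ j * c) : ℤ) : ℚ) * t / ((ℓ : ℚ) * c) -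
          12 * (Int.sign c : ℚ) * dedekindSum (d + (-σ j * Int.sign c) * C) (ℓ * C / t) := by
      intro t ht j
      have hupos : (0 : ℤ) < ((ℓ * C / t : ℕ) : ℤ) := by exact_mod_cast hmod_pos t ht
      have hne : ((ℓ : ℤ) * c) / (t : ℤ) ≠ 0 := by
        rw [hdivt t ht]
        exact mul_ne_zero (mt Int.sign_eq_zero_iff_zero.mp hc0) hupos.ne'
      have hs : Int.sign (((ℓ : ℤ) * c) / (t : ℤ)) = Int.sign c := by
        rw [hdivt t ht, Int.sign_mul, Int.sign_eq_one_of_pos hupos, mul_one]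
        rcases hsgn with h | h <;> simp [h]
      have hn : (((ℓ : ℤ) * c) / (t : ℤ)).natAbs = ℓ * C / t := by
        rw [hdivt t ht, Int.natAbs_mul, Int.natAbs_sign_of_ne_zero hc0, one_mul, Int.natAbs_natCast]
      have hdvd : (t : ℤ) ∣ (ℓ : ℤ) * c := by
        have : (t : ℤ) ∣ c := Int.natCast_dvd.mpr ((Nat.dvd_of_mem_divisors ht).trans hNC)
        exact this.mul_left _
      have hqq : ((((ℓ : ℤ) * c) / (t : ℤ) : ℤ) : ℚ) = (ℓ : ℚ) * c / t := by
        rw [Int.cast_div hdvd (by exact_mod_cast (Nat.pos_of_mem_divisors ht).ne')]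
        push_cast; rfl
      have hD : d - σ j * c = d + (-σ j * Int.sign c) * C := by
        conv_lhs => rw [hcC]
        ring
      rw [rademacherPhi_of_c_ne_zero hne, hs, hn, hqq, hD, div_div_eq_mul_div]
    have hPhi' : ∀ t ∈ N.divisors,
        rademacherPhi a (t * b) (c / t) d =
          ((a + d : ℤ) : ℚ) * t / c - 12 * (Int.sign c : ℚ) * dedekindSum d (C / t) := by
      intro t ht
      have hupos : (0 : ℤ) < ((C / t : ℕ) : ℤ) := by exact_mod_cast hmod_pos' t ht
      have hne : c / (t : ℤ) ≠ 0 := by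
        rw [hdivt' t ht]
        exact mul_ne_zero (mt Int.sign_eq_zero_iff_zero.mp hc0) hupos.ne'
      have hs : Int.sign (c / (t : ℤ)) = Int.sign c := by
        rw [hdivt' t ht, Int.sign_mul, Int.sign_eq_one_of_pos hupos, mul_one]
        rcases hsgn with h | h <;> simp [h]
      have hn : (c / (t : ℤ)).natAbs = C / t := by
        rw [hdivt' t ht, Int.natAbs_mul, Int.natAbs_sign_of_ne_zero hc0, one_mul, Int.natAbs_natCast]
      have hdvd : (t : ℤ) ∣ c := Int.natCast_dvd.mpr ((Nat.dvd_of_mem_divisors ht).trans hNC)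
      have hqq : (((c / (t : ℤ)) : ℤ) : ℚ) = (c : ℚ) / t := by
        rw [Int.cast_div hdvd (by exact_mod_cast (Nat.pos_of_mem_divisors ht).ne')]
        push_cast; rfl
      rw [rademacherPhi_of_c_ne_zero hne, hs, hn, hqq, div_div_eq_mul_div]
    -- the Dedekind-sum blocks
    have hinj : ∀ j ∈ range ℓ, ∀ j' ∈ range ℓ,
        (ℓ : ℤ) ∣ (-σ j * Int.sign c) - (-σ j' * Int.sign c) → j = j' := by
      intro j hj j' hj' h
      have h' : (ℓ : ℤ) ∣ σ j - σ j' := by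
        have e : σ j - σ j' = ((-σ j * Int.sign c) - (-σ j' * Int.sign c)) * (-Int.sign c) := by
          rcases hsgn with hh | hh
          · rw [hh]; ring
          · rw [hh]; ring
        rw [e]; exact h.mul_right _
      exact transfer_index_injective hℓ hdet hℓc σ hσ (mem_range.mp hj) (mem_range.mp hj') h'
    have hG := sum_divisors_stabCoeff_mul_sum_dedekindSum_eq_of_factorization_eq_one hℓ hℓN β hβ hNC hC0 d
      (fun j => -σ j * Int.sign c) hinj
    -- the rational parts are multiples of `∑_t c_t t = 0`
    set S : ℚ := ∑ j ∈ range ℓ, ((a + j * c + (d - σ j * c) : ℤ) : ℚ) with hS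
    have per_t : ∀ t ∈ N.divisors,
        ∑ j ∈ range ℓ, stabCoeff N β t *
          rademacherPhi (a + j * c) (t * ((b + j * d - σ j * (a + j * c)) / ℓ)) ((ℓ : ℤ) * c / t) (d - σ j * c) =
        stabCoeff N β t * t * (S / ((ℓ : ℚ) * c)) - 12 * (Int.sign c : ℚ) *
          (stabCoeff N β t * ∑ j ∈ range ℓ, dedekindSum (d + (-σ j * Int.sign c) * C) (ℓ * C / t)) := by
      intro t ht
      rw [sum_congr rfl fun j _ => by rw [hPhi t ht j]]
      rw [sum_congr rfl fun j _ => show stabCoeff N β t *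
          (((a + j * c + (d - σ j * c) : ℤ) : ℚ) * t / ((ℓ : ℚ) * c) -
            12 * (Int.sign c : ℚ) * dedekindSum (d + (-σ j * Int.sign c) * C) (ℓ * C / t)) =
          (stabCoeff N β t * t / ((ℓ : ℚ) * c)) * ((a + j * c + (d - σ j * c) : ℤ) : ℚ) -
            (12 * (Int.sign c : ℚ) * stabCoeff N β t) * dedekindSum (d + (-σ j * Int.sign c) * C) (ℓ * C / t) by
          ring]
      rw [sum_sub_distrib, ← mul_sum, ← mul_sum, hS]
      field_simp
    have per_t' : ∀ t ∈ N.divisors, stabCoeff N β t * rademacherPhi a (t * b) (c / t) d =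
        stabCoeff N β t * t * (((a + d : ℤ) : ℚ) / c) - 12 * (Int.sign c : ℚ) *
          (stabCoeff N β t * dedekindSum d (C / t)) := by
      intro t ht
      rw [hPhi' t ht]
      field_simp
    rw [sum_congr rfl per_t, sum_sub_distrib, ← sum_mul, ← mul_sum, hsumt,
      sum_congr rfl per_t', sum_sub_distrib, ← sum_mul, ← mul_sum, hsumt]
    linear_combination (-12 * (Int.sign c : ℚ)) * hG

end Summit.BirchSwinnertonDyer.BirchSwinnertonDyer.Theorems.DepletionAtTwo

end
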